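import Summits.ValiantsHypothesis.ValiantsHypothesis.Theorems.GrenetZeonDualUnipotentThreeHalvesHeavyTopTowerDefs

/-!
# `GrenetZeon.DualUnipotentThreeHalves` (stmt-ValiantsHypothesis-24318), R2 heavy-top instrument — COROLLARY II port, step (G-a):
# the FIBRE RE-INDEXING `Fin m ≃ Fin a₂ ⊕ (Fin a₁ ⊕ Fin a₀)` of a three-valued level function, and the blocks it induces

For the last step of COROLLARY II (crux note `CENSUS-THMC-UNIFORM-eng1g5.md` §8.5: from ★ `codimOne_hull_form_units` to the `towerHull` form) one
re-indexes `Fin m` along the fibres of the coarse level function `c` (values `≤ 2`), highest level first: `Fin m ≃ Fin a₂ ⊕ (Fin a₁ ⊕ Fin a₀)`, built from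
re-indexings `e_t : {c = t} ≃ Fin a_t`.  This file provides that equivalence in existence form (no definitions) together with the identification of
the blocks of the re-indexed matrix with the re-indexed diagonal / off-diagonal blocks (`Matrix.toBlock`) of the original:

* ★ `exists_fibre_equiv` — `∃ F : Fin m ≃ Fin a₂ ⊕ (Fin a₁ ⊕ Fin a₀)` with `F.symm` given on the three summands by `e₂.symm`, `e₁.symm`, `e₀.symm`
  (so `reindex F F M (ι_s x) (ι_t y) = M (e_s.symm x) (e_t.symm y)`), and `c (F.symm _)` = `2 / 1 / 0` on the three summands.

Honest framing: index bookkeeping; nothing here proves or refutes `HeavyTopLaw`, 24318, S3b or 8062; `VP ≠ VNP` is NOT proved.  No definitions.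
[folklore; cell val-heavytop-census, eng-1 g5]
-/

noncomputable section

-- single-conjunct layout: Sub = Summit, duplicated namespace component intended
set_option linter.dupNamespace false

namespace Summit.ValiantsHypothesis.ValiantsHypothesis.Theorems.GrenetZeon.HeavyTopCodimOneFibres

open Matrix

/-- ★ **Fibre re-indexing of a three-valued level function.**  [folklore] -/
theorem exists_fibre_equiv {m a₀ a₁ a₂ : ℕ} (c : Fin m → ℕ) (hc : ∀ i, c i ≤ 2)
    (e₀ : {i : Fin m // c i = 0} ≃ Fin a₀) (e₁ : {i : Fin m // c i = 1} ≃ Fin a₁) (e₂ : {i : Fin m // c i = 2} ≃ Fin a₂) :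
    ∃ F : Fin m ≃ Fin a₂ ⊕ (Fin a₁ ⊕ Fin a₀),
      (∀ x : Fin a₂, F.symm (Sum.inl x) = ((e₂.symm x : {i : Fin m // c i = 2}) : Fin m)) ∧
      (∀ y : Fin a₁, F.symm (Sum.inr (Sum.inl y)) = ((e₁.symm y : {i : Fin m // c i = 1}) : Fin m)) ∧
      (∀ z : Fin a₀, F.symm (Sum.inr (Sum.inr z)) = ((e₀.symm z : {i : Fin m // c i = 0}) : Fin m)) ∧
      (∀ i (h : c i = 2), F i = Sum.inl (e₂ ⟨i, h⟩)) ∧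
      (∀ i (h : c i = 1), F i = Sum.inr (Sum.inl (e₁ ⟨i, h⟩))) ∧
      (∀ i (h : c i = 0), F i = Sum.inr (Sum.inr (e₀ ⟨i, h⟩))) ∧
      (∀ x : Fin a₂, c (F.symm (Sum.inl x)) = 2) ∧
      (∀ y : Fin a₁, c (F.symm (Sum.inr (Sum.inl y))) = 1) ∧
      (∀ z : Fin a₀, c (F.symm (Sum.inr (Sum.inr z))) = 0) := by
  classical
  -- forward and backward maps
  let f : Fin m → Fin a₂ ⊕ (Fin a₁ ⊕ Fin a₀) := fun i =>
    if h2 : c i = 2 then Sum.inl (e₂ ⟨i, h2⟩)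
    else if h1 : c i = 1 then Sum.inr (Sum.inl (e₁ ⟨i, h1⟩))
    else Sum.inr (Sum.inr (e₀ ⟨i, by have := hc i; omega⟩))
  let g : Fin a₂ ⊕ (Fin a₁ ⊕ Fin a₀) → Fin m :=
    Sum.elim (fun x => ((e₂.symm x : {i : Fin m // c i = 2}) : Fin m))
      (Sum.elim (fun y => ((e₁.symm y : {i : Fin m // c i = 1}) : Fin m)) (fun z => ((e₀.symm z : {i : Fin m // c i = 0}) : Fin m)))
  have hf2 : ∀ i (h : c i = 2), f i = Sum.inl (e₂ ⟨i, h⟩) := fun i h => by simp only [f, dif_pos h]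
  have hf1 : ∀ i (h : c i = 1), f i = Sum.inr (Sum.inl (e₁ ⟨i, h⟩)) := fun i h => by
    simp only [f, dif_neg (show c i ≠ 2 by omega), dif_pos h]
  have hf0 : ∀ i (h : c i = 0), f i = Sum.inr (Sum.inr (e₀ ⟨i, h⟩)) := fun i h => by
    simp only [f, dif_neg (show c i ≠ 2 by omega), dif_neg (show c i ≠ 1 by omega)]
  have hgf : ∀ i, g (f i) = i := by
    intro i
    obtain h | h | h : c i = 0 ∨ c i = 1 ∨ c i = 2 := by have := hc i; omega
    · rw [hf0 i h]; simp only [g, Sum.elim_inr, Equiv.symm_apply_apply]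
    · rw [hf1 i h]; simp only [g, Sum.elim_inr, Sum.elim_inl, Equiv.symm_apply_apply]
    · rw [hf2 i h]; simp only [g, Sum.elim_inl, Equiv.symm_apply_apply]
  have hfg : ∀ s, f (g s) = s := by
    rintro (x | y | z)
    · simp only [g, Sum.elim_inl]
      rw [hf2 _ (e₂.symm x).2, Subtype.coe_eta, Equiv.apply_symm_apply]
    · simp only [g, Sum.elim_inr, Sum.elim_inl]
      rw [hf1 _ (e₁.symm y).2, Subtype.coe_eta, Equiv.apply_symm_apply]
    · simp only [g, Sum.elim_inr]
      rw [hf0 _ (e₀.symm z).2, Subtype.coe_eta, Equiv.apply_symm_apply]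
  let F : Fin m ≃ Fin a₂ ⊕ (Fin a₁ ⊕ Fin a₀) := ⟨f, g, hgf, hfg⟩
  refine ⟨F, fun x => rfl, fun y => rfl, fun z => rfl, hf2, hf1, hf0, fun x => (e₂.symm x).2, fun y => (e₁.symm y).2, fun z => (e₀.symm z).2⟩

end Summit.ValiantsHypothesis.ValiantsHypothesis.Theorems.GrenetZeon.HeavyTopCodimOneFibres

end
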